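import Summits.ResolutionOfSingularities.ResolutionOfSingularities.Theorems.PurelyInseparableDim4ResConePowerConeTilt
import Summits.ResolutionOfSingularities.ResolutionOfSingularities.Theorems.PurelyInseparableDim4ResConeShearTransport
import Summits.ResolutionOfSingularities.ResolutionOfSingularities.Theorems.PurelyInseparableDim4ResConeTwoSlotFlag
import HarnessLib
import HarnessLib.Audit.Tags

/-!
# Purely inseparable four-folds — C∞ PINNING, free half, TWO-STATE FORM: a slot step of a C∞-presented state
# whose child keeps order `6` and `e_G = 3` has no `u`-translation (K24b-R1 stub `(VT-u)`, cell `res-dim4-pi`,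
# K2(p) lane, slice B)

[OURS · counted 0 · cell `res-dim4-pi` · K2(p) lane; desk WORD 2026-08-29 05:04:42Z («`stub_VTu_twoState` is p-2's by
lineage»), binders = res-dim4-typ-1 g3's `K24b-R1-WINDOW-SKELETON.lean` (sha16 25e0f240a545ec23) ll.37–45 VERBATIM; seat
res-dim4-p-2 g5 over its predecessor's chain form `cInf_translation_u_eq_zero` (`…ResConeCInfPinningU`, p691582), the
holder's two-state alignment lemma `exists_births_eq_mul_of_finrank_step_eq_three` (`…ResConePowerConeTilt`, p675934) and
res-dim4-p-5 g3's one-letter shear law `coeff_shear_single` (`…ResConeShearTransport`).]  Nothing here proves K2(p)/K2(5),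
`NoIsolatedTrap p p` or resolution of singularities in dimension ≥ 4 / characteristic `p`.  AI kernel work, weaker than
expert review.

THE STATEMENT (`cInf_translation_u_eq_zero_twoState`).  Letters `λ μ | u f` pairwise distinct; a state `s` with ledger
`r = e_λ + e_μ`, order `6`, `x^r ∣ F`, STRAIGHT residual cone `resForm s = a·x_f⁴` (`a ≠ 0`), the exact pair-ledger support
form «`e_f ≤ 3 ⇒ e_λ, e_μ ≥ 2`», the dead `ū²`-row «no monomial with `u`-exponent `2` and `f`-exponent `0` below degree
`N ≥ 8`», and the `u`-axis flag `V = coeff (r + λ + μ + 3u) F ≠ 0`.  If the child by the slot step `ℓ ∈ {λ, μ}` with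
translation `β·e_u` has order `6` and `e_G = 3`, then `β = 0`.

THE PROOF (no chain).  §1 `mem_resVertex_iff_of_resForm_eq_C_mul_X_pow`: the vertex of a straight cone `a·x_f^n`
(`1 ≤ n < p`) is the hyperplane `{w_f = 0}` (polar map).  §2 `step_r_single_free_eq`: the slot step along the free letter
keeps the ledger `e_λ + e_μ` (p-9's `step_r_univ`), so the shade is kept.  §3 the holder's `exists_births_eq_mul_of_finrank_step_eq_three`
(parent vertex `{w_f = 0}`, child `e_G = 3`) makes the birth layer `coeff_{μ₀ + 2e_ℓ} (shear_ℓ^{β e_u} G)` proportional to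
`coeff_{μ₀} (x_f³)`, hence ZERO at `μ₀ = e_{other slot} + 2e_u`; `coeff_shear_single` reads that birth as
`1·coeff(r + 2ℓ + o + 2u) + 3β·V + 6β²·coeff(r + o + 4u) = 0 + 3βV + 0` (dead row at degree `7 < N`; ledger: `ℓ`-exponent
`1 < 2` at `f`-degree `0`), so `β = 0` (`3 ≠ 0` in characteristic `5`).  The core `…_core` is stated for the chart letter `κ`
and the other slot `o`; the export instantiates `(κ, o) = (λ, μ)` or `(μ, λ)`.

[cite: CossartJannsenSaito2020, Thm. 3.10(4), Thm. 9.3] bears_on: LADDER-RESOLUTION:D157-DOOR2 (res-dim4-pi · K2(p) ·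
slice B · K24b-R1 (VT-u) two-state).  Supports stmt-ResolutionOfSingularities-16155 (helper).
-/

set_option linter.dupNamespace false -- mandated namespace of this single-conjunct summit

noncomputable section

namespace Summit.ResolutionOfSingularities.ResolutionOfSingularities.Theorems.PIDim4

namespace ResCone

open MvPolynomial Finset
open Literature.AlgebraicGeometry.Resolution
open Literature.AlgebraicGeometry.Resolution.CentreBlowup
open Literature.AlgebraicGeometry.Resolution.Hauser2010
open Literature.AlgebraicGeometry.Resolution.HauserPerlega2019
open PointBlowup (polarMap additiveSubspace)

variable {K : Type} [Field K]

/-! ## 1. The vertex of a straight cone -/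

/-- **The vertex of a straight cone is the contact hyperplane**: if `resForm s = a·x_f^n` with `a ≠ 0` and
`1 ≤ n < p`, then `resVertex s = {w : w_f = 0}` (the polar map is `w ↦ n·a·w_f·x_f^{n−1}`). [folklore]
[cite: CossartJannsenSaito2020, Def. 2.18 and Def. 2.21] -/
theorem mem_resVertex_iff_of_resForm_eq_C_mul_X_pow (p : ℕ) [Fact p.Prime] [CharP K p] {s : State K} {a : K}
    (ha : a ≠ 0) {f : Fin 4} {n : ℕ} (hn1 : 1 ≤ n) (hnp : n < p) (hform : resForm s = C a * X f ^ n)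
    (w : Fin 4 → K) : w ∈ resVertex s ↔ dotProduct (Pi.single f (1 : K)) w = 0 := by
  classical
  unfold resVertex additiveSubspace
  rw [LinearMap.mem_ker, NarrowApolarity.polarMap_apply, hform, C_mul_X_pow_eq_monomial, single_dotProduct, one_mul,
    Finset.sum_eq_single f (fun i _ hif => by
      rw [pderiv_monomial, Finsupp.single_eq_of_ne hif, Nat.cast_zero, mul_zero, monomial_zero, smul_zero])
      (fun h => absurd (Finset.mem_univ f) h),
    pderiv_monomial_single, smul_monomial, smul_eq_mul, monomial_eq_zero]
  have hn : ((n : ℕ) : K) ≠ 0 := natCast_ne_zero_of_lt p hn1 hnp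
  constructor
  · intro h
    rcases mul_eq_zero.mp h with h | h
    · exact h
    · rcases mul_eq_zero.mp h with h | h
      · exact absurd h ha
      · exact absurd h hn
  · intro h
    rw [h, zero_mul]

/-! ## 2. The ledger through a slot step along the free letter -/

section Step

variable [DecidableEq K]

/-- **A slot step translated along the free letter keeps the two-slot ledger**: with `r = e_κ + e_o`, order `6`,
`x^r ∣ F`, the step in chart `κ` with translation `β·e_u` (`u ∉ {κ, o}`) has `r′ = e_κ + e_o` (`q = 5`).
[folklore] [cite: HauserPerlega2019PRIMS, §2 (transform D' of D)] -/
theorem step_r_single_free_eq {κ o u f : Fin 4} (hκo : κ ≠ o) (hκu : κ ≠ u) (hκf : κ ≠ f) (hou : o ≠ u) (hof : o ≠ f)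
    (huf : u ≠ f) {s : State K} (hr : s.r = Finsupp.single κ 1 + Finsupp.single o 1) (ho : ordZero s.F = 6)
    (hdiv : ∀ e ∈ s.F.support, s.r ≤ e) (β : K) :
    (CentreBlowup.step 5 Finset.univ κ (Pi.single u β) s).r = Finsupp.single κ 1 + Finsupp.single o 1 := by
  have hbκ : (Pi.single u β : Fin 4 → K) κ = 0 := by rw [Pi.single_eq_of_ne hκu]
  rw [step_r_univ 5 κ hbκ s ho hdiv, hr]
  have hr4 : (Finsupp.single κ 1 + Finsupp.single o 1 : Fin 4 →₀ ℕ) =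
      Finsupp.single κ 1 + Finsupp.single o 1 + Finsupp.single u 0 + Finsupp.single f 0 := by
    rw [Finsupp.single_zero, Finsupp.single_zero, add_zero, add_zero]
  obtain ⟨h1, h2, h3, h4⟩ := quad_apply hκo hκu hκf hou hof huf 1 1 0 0
  rw [← hr4] at h1 h2 h3 h4
  ext i
  rw [Finsupp.update_apply, Finsupp.filter_apply]
  rcases letters_exhaust hκo hκu hκf hou hof huf i with h | h | h | h <;> rw [h]
  · rw [if_pos rfl, h1]
  · rw [if_neg hκo.symm, if_pos (show (Pi.single u β : Fin 4 → K) o = 0 by rw [Pi.single_eq_of_ne hou]), h2]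
  · rw [if_neg hκu.symm, h3]; exact ite_self 0
  · rw [if_neg hκf.symm, h4]; exact ite_self 0

/-! ## 3. The two-state (VT-u) -/

/-- **(VT-u), TWO-STATE CORE** (chart `κ`, other slot `o`, free letters `u`, `f`): see the module docstring.  The child of
the slot step `κ` with translation `β·e_u` having order `6` and `e_G = 3` forces `β = 0`. [OURS]
[cite: CossartJannsenSaito2020, Thm. 3.10(4), Thm. 9.3] -/
theorem cInf_translation_u_eq_zero_twoState_core [CharP K 5] {κ o u f : Fin 4} (hκo : κ ≠ o) (hκu : κ ≠ u)
    (hκf : κ ≠ f) (hou : o ≠ u) (hof : o ≠ f) (huf : u ≠ f) {s : State K}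
    (hr : s.r = Finsupp.single κ 1 + Finsupp.single o 1) (ho : ordZero s.F = 6)
    (hdiv : ∀ e ∈ s.F.support, s.r ≤ e) {a : K} (ha : a ≠ 0) (hform : resForm s = C a * X f ^ 4)
    (hled : ∀ e ∈ s.F.support, e f ≤ 3 → 2 ≤ e κ ∧ 2 ≤ e o) {N : ℕ} (hN : 8 ≤ N)
    (hrow : ∀ d ∈ s.F.support, d.degree < N → ¬ (d u = 2 ∧ d f = 0))
    (hV : coeff (s.r + (Finsupp.single κ 1 + Finsupp.single o 1 + Finsupp.single u 3)) s.F ≠ 0)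
    {β : K} (ho' : ordZero (CentreBlowup.step 5 Finset.univ κ (Pi.single u β) s).F = 6)
    (he3' : Module.finrank K (resVertex (CentreBlowup.step 5 Finset.univ κ (Pi.single u β) s)) = 3) : β = 0 := by
  classical
  haveI : Fact (Nat.Prime 5) := ⟨by norm_num⟩
  have hbκ : (Pi.single u β : Fin 4 → K) κ = 0 := by rw [Pi.single_eq_of_ne hκu]
  have hrdeg : s.r.degree = 2 := by rw [hr, map_add, Finsupp.degree_single, Finsupp.degree_single]
  -- the shade is kept
  have hr' := step_r_single_free_eq hκo hκu hκf hou hof huf hr ho hdiv β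
  have hrdeg' : (CentreBlowup.step 5 Finset.univ κ (Pi.single u β) s).r.degree = 2 := by
    rw [hr', map_add, Finsupp.degree_single, Finsupp.degree_single]
  have heq : (CentreBlowup.step 5 Finset.univ κ (Pi.single u β) s).shade = s.shade := by
    rw [BandShade.shade_eq_coe ho', BandShade.shade_eq_coe ho, hrdeg, hrdeg']
  -- the parent's vertex is `{w_f = 0}`
  have hV0 : ∀ w, w ∈ resVertex s ↔ dotProduct (Pi.single f (1 : K)) w = 0 :=
    mem_resVertex_iff_of_resForm_eq_C_mul_X_pow 5 ha (n := 4) (by norm_num) (by norm_num) hform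
  have hℓ0 : (Pi.single f (1 : K) : Fin 4 → K) ≠ 0 := fun h => by
    have h1 := congr_fun h f
    rw [Pi.single_eq_same, Pi.zero_apply] at h1
    exact one_ne_zero h1
  -- the birth layer is aligned with `x_f³`
  obtain ⟨κ', hB⟩ := exists_births_eq_mul_of_finrank_step_eq_three 5 κ hbκ ho hdiv (by norm_num) (by norm_num) heq
    (by rw [hrdeg]; norm_num) hV0 hℓ0 he3'
  -- the birth at `μ₀ = e_o + 2e_u` vanishes
  set μ₀ : Fin 4 →₀ ℕ := Finsupp.single o 1 + Finsupp.single u 2 with hμ₀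
  have hμ₀κ : μ₀ κ = 0 := by
    rw [hμ₀, Finsupp.add_apply, Finsupp.single_eq_of_ne hκo, Finsupp.single_eq_of_ne hκu, add_zero]
  have hμ₀deg : μ₀.degree + 1 = 6 - s.r.degree := by
    rw [hrdeg, hμ₀, map_add, Finsupp.degree_single, Finsupp.degree_single]
  have hBμ := hB μ₀ hμ₀κ hμ₀deg
  have hupd0 : Function.update (Pi.single f (1 : K) : Fin 4 → K) κ 0 = (Pi.single f (1 : K) : Fin 4 → K) := by
    funext i
    by_cases hi : i = κ
    · subst hi; rw [Function.update_self, Pi.single_eq_of_ne hκf]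
    · rw [Function.update_of_ne hi]
  have hsum : (∑ i, C ((Pi.single f (1 : K) : Fin 4 → K) i) * X i : MvPolynomial (Fin 4) K) = X f := by
    rw [Finset.sum_eq_single f (fun i _ hif => by rw [Pi.single_eq_of_ne hif, C_0, zero_mul])
      (fun h => absurd (Finset.mem_univ f) h), Pi.single_eq_same, C_1, one_mul]
  have hcoef0 : coeff μ₀ ((∑ i, C (Function.update (Pi.single f (1 : K) : Fin 4 → K) κ 0 i) * X i :
      MvPolynomial (Fin 4) K) ^ (6 - s.r.degree - 1)) = 0 := by
    rw [hupd0, hsum, hrdeg, show 6 - 2 - 1 = 3 by rfl, X_pow_eq_monomial, coeff_monomial, if_neg]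
    intro h
    have h1 := DFunLike.congr_fun h u
    rw [Finsupp.single_eq_of_ne huf, hμ₀, Finsupp.add_apply, Finsupp.single_eq_of_ne hou.symm,
      Finsupp.single_eq_same] at h1
    omega
  rw [hcoef0, mul_zero] at hBμ
  -- read the birth through the one-letter shear: `1·0 + 3·β·V + 6·β²·0`
  rw [coeff_shear_single hκu β] at hBμ
  have heκ : (μ₀ + Finsupp.single κ 2 : Fin 4 →₀ ℕ) κ = 2 := by
    rw [Finsupp.add_apply, hμ₀κ, Finsupp.single_eq_same]
  have heu : (μ₀ + Finsupp.single κ 2 : Fin 4 →₀ ℕ) u = 2 := by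
    rw [Finsupp.add_apply, hμ₀, Finsupp.add_apply, Finsupp.single_eq_of_ne hou.symm, Finsupp.single_eq_same,
      Finsupp.single_eq_of_ne hκu.symm]
    rfl
  rw [heκ, heu, Finset.sum_range_succ, Finset.sum_range_succ, Finset.sum_range_succ, Finset.sum_range_zero,
    zero_add] at hBμ
  -- the three exponents, in `F`-coordinates
  have hupd : ∀ x y x' y' : ℕ, x = x' → y = y' →
      ((μ₀ + Finsupp.single κ 2).update κ x).update u y =
        Finsupp.single κ x' + Finsupp.single o 1 + Finsupp.single u y' + Finsupp.single f 0 := by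
    intro x y x' y' hx hy
    subst hx; subst hy
    obtain ⟨h1, h2, h3, h4⟩ := quad_apply hκo hκu hκf hou hof huf x 1 y 0
    ext i
    simp only [Finsupp.coe_update]
    rcases letters_exhaust hκo hκu hκf hou hof huf i with h | h | h | h <;> rw [h]
    · rw [Function.update_of_ne hκu, Function.update_self, h1]
    · rw [Function.update_of_ne hou, Function.update_of_ne hκo.symm, h2, Finsupp.add_apply, hμ₀, Finsupp.add_apply,
        Finsupp.single_eq_same, Finsupp.single_eq_of_ne hou, Finsupp.single_eq_of_ne hκo.symm]
      omega
    · rw [Function.update_self, h3]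
    · rw [Function.update_of_ne huf.symm, Function.update_of_ne hκf.symm, h4, Finsupp.add_apply, hμ₀,
        Finsupp.add_apply, Finsupp.single_eq_of_ne hof.symm, Finsupp.single_eq_of_ne huf.symm,
        Finsupp.single_eq_of_ne hκf.symm]
      omega
  have he0 : ((μ₀ + Finsupp.single κ 2).update κ (2 - 0)).update u (2 + 0) =
      Finsupp.single κ 2 + Finsupp.single o 1 + Finsupp.single u 2 + Finsupp.single f 0 := hupd _ _ 2 2 rfl rfl
  have he1 : ((μ₀ + Finsupp.single κ 2).update κ (2 - 1)).update u (2 + 1) =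
      Finsupp.single κ 1 + Finsupp.single o 1 + Finsupp.single u 3 + Finsupp.single f 0 := hupd _ _ 1 3 rfl rfl
  have he2 : ((μ₀ + Finsupp.single κ 2).update κ (2 - 2)).update u (2 + 2) =
      Finsupp.single κ 0 + Finsupp.single o 1 + Finsupp.single u 4 + Finsupp.single f 0 := hupd _ _ 0 4 rfl rfl
  -- the dead `ū²`-row entry (degree `7 < N`)
  have hnf : coeff (s.r + (Finsupp.single κ 2 + Finsupp.single o 1 + Finsupp.single u 2 + Finsupp.single f 0)) s.F = 0 := by
    by_contra h
    have hmem := mem_support_iff.mpr h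
    obtain ⟨-, -, h3, h4⟩ := quad_apply hκo hκu hκf hou hof huf (1 + 2) (1 + 1) 2 0
    have heq' : s.r + (Finsupp.single κ 2 + Finsupp.single o 1 + Finsupp.single u 2 + Finsupp.single f 0) =
        Finsupp.single κ (1 + 2) + Finsupp.single o (1 + 1) + Finsupp.single u 2 + Finsupp.single f 0 := by
      rw [hr, Finsupp.single_add, Finsupp.single_add]
      abel
    rw [heq'] at hmem
    exact hrow _ hmem (by rw [degree_quad]; omega) ⟨h3, h4⟩
  -- the pair-ledger entry (`κ`-exponent `1 < 2` at `f`-degree `0`)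
  have hW : coeff (s.r + (Finsupp.single κ 0 + Finsupp.single o 1 + Finsupp.single u 4 + Finsupp.single f 0)) s.F = 0 := by
    by_contra h
    have hmem := mem_support_iff.mpr h
    obtain ⟨h1, -, -, h4⟩ := quad_apply hκo hκu hκf hou hof huf (1 + 0) (1 + 1) 4 0
    have heq' : s.r + (Finsupp.single κ 0 + Finsupp.single o 1 + Finsupp.single u 4 + Finsupp.single f 0) =
        Finsupp.single κ (1 + 0) + Finsupp.single o (1 + 1) + Finsupp.single u 4 + Finsupp.single f 0 := by
      rw [hr, Finsupp.single_add, Finsupp.single_add]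
      abel
    rw [heq'] at hmem
    have h2 := (hled _ hmem (by rw [h4]; norm_num)).1
    rw [h1] at h2
    exact absurd h2 (by norm_num)
  -- the flag entry, in the same coordinates
  have hV' : coeff (s.r + (Finsupp.single κ 1 + Finsupp.single o 1 + Finsupp.single u 3 + Finsupp.single f 0)) s.F ≠ 0 := by
    rw [Finsupp.single_zero, add_zero]
    exact hV
  rw [he0, he1, he2, coeff_divMonomial, coeff_divMonomial, coeff_divMonomial, hnf, hW] at hBμ
  -- `hBμ : _ * 0 + 3 * β * V + _ * 0 = 0`
  have h3 : ((2 + 1 : ℕ).choose 1 : K) ≠ 0 := by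
    rw [show (2 + 1 : ℕ).choose 1 = 3 by rfl]
    exact natCast_ne_zero_of_lt 5 (by norm_num) (by norm_num)
  have hkey : ((2 + 1 : ℕ).choose 1 : K) * β ^ 1 *
      coeff (s.r + (Finsupp.single κ 1 + Finsupp.single o 1 + Finsupp.single u 3 + Finsupp.single f 0)) s.F = 0 := by
    have h := hBμ
    simp only [mul_zero, zero_add, add_zero] at h
    exact h
  rw [pow_one] at hkey
  rcases mul_eq_zero.mp hkey with h | h
  · rcases mul_eq_zero.mp h with h' | h'
    · exact absurd h' h3
    · exact h'
  · exact absurd h hV'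

/-- **(VT-u), TWO-STATE EXPORT** (res-dim4-typ-1 g3's `stub_VTu_twoState`, binders verbatim): a C∞-presented state — fixed
letters `λ μ | u f`, ledger `x_λ x_μ`, order `6`, `x^r ∣ F`, straight residual cone `a·x_f⁴`, exact pair ledger, dead
`ū²`-row below `N ≥ 8`, flag `V ≠ 0` — whose child by a slot step `ℓ ∈ {λ, μ}` with translation supported on `u` alone
is again of order `6` with `e_G = 3` has NO `u`-translation. [OURS] [cite: CossartJannsenSaito2020, Thm. 3.10(4), Thm. 9.3] -/
theorem cInf_translation_u_eq_zero_twoState [CharP K 5] {la mu u f : Fin 4} (hlm : la ≠ mu) (hlu : la ≠ u)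
    (hlf : la ≠ f) (hmu : mu ≠ u) (hmf : mu ≠ f) (huf : u ≠ f) {s : State K} {ℓ : Fin 4} (hℓ : ℓ = la ∨ ℓ = mu)
    (hr : s.r = Finsupp.single la 1 + Finsupp.single mu 1) (ho : ordZero s.F = 6)
    (hdiv : ∀ e ∈ s.F.support, s.r ≤ e) {a : K} (ha : a ≠ 0) (hform : resForm s = C a * X f ^ 4)
    (hled : ∀ e ∈ s.F.support, e f ≤ 3 → 2 ≤ e la ∧ 2 ≤ e mu) {N : ℕ} (hN : 8 ≤ N)
    (hrow : ∀ d ∈ s.F.support, d.degree < N → ¬ (d u = 2 ∧ d f = 0))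
    (hV : coeff (s.r + (Finsupp.single la 1 + Finsupp.single mu 1 + Finsupp.single u 3)) s.F ≠ 0)
    {β : K} (ho' : ordZero (CentreBlowup.step 5 Finset.univ ℓ (Pi.single u β) s).F = 6)
    (he3' : Module.finrank K (resVertex (CentreBlowup.step 5 Finset.univ ℓ (Pi.single u β) s)) = 3) : β = 0 := by
  rcases hℓ with h | h <;> subst h
  · exact cInf_translation_u_eq_zero_twoState_core hlm hlu hlf hmu hmf huf hr ho hdiv ha hform hled hN hrow hV ho' he3'
  · refine cInf_translation_u_eq_zero_twoState_core hlm.symm hmu hmf hlu hlf huf (by rw [hr, add_comm]) ho hdiv ha hform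
      (fun e he hf => (hled e he hf).symm) hN hrow ?_ ho' he3'
    rw [show (Finsupp.single ℓ 1 + Finsupp.single la 1 + Finsupp.single u 3 : Fin 4 →₀ ℕ) =
      Finsupp.single la 1 + Finsupp.single ℓ 1 + Finsupp.single u 3 by abel]
    exact hV

end Step

end ResCone

end Summit.ResolutionOfSingularities.ResolutionOfSingularities.Theorems.PIDim4

end
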